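import Literature.NumberTheory.NumberFields.CMFieldAmbiguousClassNumber
import Literature.NumberTheory.NumberFields.CyclotomicTowerClassNumberCoprime
import Literature.NumberTheory.NumberFields.CyclotomicFieldFourClassNumber
import Literature.NumberTheory.NumberFields.ClassGroupNormSurjective
import Mathlib.NumberTheory.NumberField.Cyclotomic.Ideal
import Mathlib.NumberTheory.NumberField.CMField
import HarnessLib

/-!
# The maximal real subfield `ℚ(ζ_{2^{k+2}})⁺` has ODD NARROW class number (Weber; genus theory for `ℚ(ζ)/ℚ(ζ)⁺`)

Topic `NumberTheory/NumberFields` (namespace = path).  THEOREM-ONLY file (no definition, no named fact, no instance, no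
`sorry`), written by the prover seat `bsd-2adic-conv-1` GEN 33 (cell `bsd-2adic`; pen RC-450 key «FW-IQ-GENUS»: the Ferrero–Washington
input of the S3 crux line `kato_determinant_greenberg_two` of stmt-BirchSwinnertonDyer-19556 is consumed only as Iwasawa's `μ = 0` for the
cyclotomic `ℤ₂`-extension of ONE imaginary quadratic field, which genus theory (Kida 1979 / Ferrero 1980) gives from exactly the parity
statement proved here; closes nothing by itself).

WHAT.  For every number field `N` with `IsCyclotomicExtension {2 ^ (k + 2)} ℚ N` (`N ≅ ℚ(ζ_{2^{k+2}})`, `k ≥ 0`, a CM field with maximal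
real subfield `N⁺ ≅ ℚ(ζ_{2^{k+2}} + ζ_{2^{k+2}}⁻¹)` of degree `2^k` = the `k`-th layer of the cyclotomic `ℤ₂`-extension of `ℚ`):

* §1 `odd_classNumber_of_isCyclotomicExtension_two_pow` — **Weber: `h(ℚ(ζ_{2^{k+2}}))` is odd** (tree, Washington Cor. 10.5
  `dvd_classNumber_iff_of_isCyclotomicExtension_prime_pow` at the base `ℚ(ζ₄)`, `h(ℚ(ζ₄)) = 1`: `classNumber_cyclotomicField_four`);
  `odd_classNumber_maximalRealSubfield_of_isCyclotomicExtension_two_pow` — `h(N⁺)` is odd (`h(N⁺) ∣ h(N)` for every CM field,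
  `IsCMField.card_classGroup_maximalRealSubfield_dvd`).
* §2 `card_twoTorsion_classGroup_eq_one_of_odd_classNumber` — a class group of odd order has trivial `2`-torsion.
* §3 the ramification of `N/N⁺`: `N⁺` has exactly one prime `v₀` above `2` (Mathlib: the unique prime `(ζ − 1)` of `N` above `2`,
  `IsCyclotomicExtension.Rat.eq_span_zeta_sub_one_of_liesOver`), `N/N⁺` is RAMIFIED at `v₀` (`e((ζ−1) ∣ 2) = 2^{k+1} = [N : ℚ]`
  exceeds `[N⁺ : ℚ] = 2^k ≥ e(v₀ ∣ 2)`, tower formula `Ideal.ramificationIdx_tower`) and UNRAMIFIED at every other finite prime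
  (`IsCyclotomicExtension.Rat.ramificationIdx_eq_of_not_dvd` + tower) — `N/N⁺` has `t = 1`.
* §4 **`odd_narrowClassNumber_maximalRealSubfield_of_isCyclotomicExtension_two_pow` — `h⁺(ℚ(ζ_{2^{k+2}})⁺)` is odd**: Horie 1994
  Lemma 1 (ii) at `t = 1` (tree `IsCMField.card_twoTorsion_classGroup_eq_card_totPosUnitsModSq_of_odd_of_isUnramifiedIn`:
  `#Cl(N)[2] · h(N⁺) = h⁺(N⁺)`) with `#Cl(N)[2] = 1`.  Equivalently (Weber 1899 / Hasse): the totally positive units of `ℚ(ζ_{2^{k+2}})⁺`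
  are squares — units of every signature exist.

HONEST SCOPE.  Classical statements (Weber's theorem and its narrow form), no new mathematics; assembled from tree theorems and Mathlib's
ramification theory of cyclotomic fields.  Nothing here is specific to any summit; BSD is not proved by any of this.  NOT here: the odd
part of `h(ℚ(ζ_{2^n}))` (Weber's full theorem `h(ℚ(ζ_{2^n})) = 1` for `n ≤ 5`… is not claimed), other conductors.

## References
* H. Weber, *Lehrbuch der Algebra* II (1899), §§ on `ℚ(ζ_{2^n})` (class number parity); H. Hasse, *Über die Klassenzahl abelscher
  Zahlkörper* (1952), Satz 25 (units of all signatures).  Not held; cited through: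
* L. C. Washington, *Introduction to Cyclotomic Fields*, 2nd ed. (1997), Thm. 10.4, Cor. 10.5. [Washington1997]
* K. Horie, *On CM-fields with the same maximal real subfield*, Acta Arith. 67 (1994), Lemma 1. [Horie1994]
* R. Okazaki, Acta Arith. 92 (2000), §3 Lemma 15 / 17. [Okazaki2000]
-/

set_option autoImplicit false

noncomputable section

open NumberField NumberField.IsCMField IsDedekindDomain Module

namespace Literature.NumberTheory.NumberFields

/-! ## §1 Weber: `h(ℚ(ζ_{2^{k+2}}))` and `h(ℚ(ζ_{2^{k+2}})⁺)` are odd -/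

section Weber

variable (N : Type) [Field N] [NumberField N] (k : ℕ) [hN : IsCyclotomicExtension {2 ^ (k + 2)} ℚ N]

include hN in
/-- **Weber: the class number of `ℚ(ζ_{2^{k+2}})` is odd** — Washington Cor. 10.5 along the `2`-power cyclotomic tower from the base
`ℚ(ζ₄) = ℚ(i)`, whose class number is `1`. [cite: Washington1997, Cor. 10.5] -/
theorem odd_classNumber_of_isCyclotomicExtension_two_pow : Odd (classNumber N) := by
  haveI : IsCyclotomicExtension {2 ^ (1 + 1)} ℚ (CyclotomicField 4 ℚ) := by
    rw [show (2 : ℕ) ^ (1 + 1) = 4 by norm_num]; exact CyclotomicField.isCyclotomicExtension 4 ℚ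
  haveI : IsCyclotomicExtension {2 ^ (1 + 1 + k)} ℚ N := by
    rw [show 1 + 1 + k = k + 2 by ring]; exact hN
  have h := dvd_classNumber_iff_of_isCyclotomicExtension_prime_pow (p := 2) (k := 1) (j := k) Nat.prime_two
    (by norm_num) (CyclotomicField 4 ℚ) N
  rw [classNumber_cyclotomicField_four, Nat.dvd_one] at h
  rcases Nat.even_or_odd (classNumber N) with he | ho
  · exact absurd (h.mpr (even_iff_two_dvd.mp he)) (by norm_num)
  · exact ho

include hN in
/-- `ℚ(ζ_{2^{k+2}})` is a CM field (Mathlib: every cyclotomic field `ℚ(ζ_m)`, `m > 2`). [cite: Washington1997, §4 (CM fields)] -/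
theorem isCMField_of_isCyclotomicExtension_two_pow : IsCMField N :=
  IsCyclotomicExtension.Rat.isCMField N (S := {2 ^ (k + 2)})
    ⟨2 ^ (k + 2), Set.mem_singleton _,
      lt_of_lt_of_le (by norm_num : 2 < 2 ^ 2) (Nat.pow_le_pow_right two_pos (Nat.le_add_left 2 k))⟩

include hN in
/-- **`h(ℚ(ζ_{2^{k+2}})⁺)` is odd**: `h(N⁺) ∣ h(N)` for the CM field `N` (the norm `Cl_N → Cl_{N⁺}` is onto, tree
`IsCMField.card_classGroup_maximalRealSubfield_dvd`). [cite: Washington1997, Thm. 4.10 and Thm. 10.4] -/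
theorem odd_classNumber_maximalRealSubfield_of_isCyclotomicExtension_two_pow :
    Odd (classNumber (maximalRealSubfield N)) := by
  haveI : IsCMField N := isCMField_of_isCyclotomicExtension_two_pow N k
  have hdvd : classNumber (maximalRealSubfield N) ∣ classNumber N :=
    IsCMField.card_classGroup_maximalRealSubfield_dvd N
  exact Odd.of_dvd_nat (odd_classNumber_of_isCyclotomicExtension_two_pow N k) hdvd

end Weber

/-! ## §2 Odd class number ⟹ trivial `2`-torsion -/

/-- A class group of odd order has no element of order `2`: `#Cl_L[2] = 1` (Lagrange). [cite: Washington1997, Thm. 10.4 (proof)] -/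
theorem card_twoTorsion_classGroup_eq_one_of_odd_classNumber (L : Type) [Field L] [NumberField L]
    (hodd : Odd (classNumber L)) : Nat.card {c : ClassGroup (𝓞 L) // c ^ 2 = 1} = 1 := by
  classical
  have hsub : ∀ c : ClassGroup (𝓞 L), c ^ 2 = 1 → c = 1 := by
    intro c hc
    have h1 : orderOf c ∣ 2 := orderOf_dvd_of_pow_eq_one hc
    have h2 : orderOf c ∣ classNumber L := orderOf_dvd_card
    have hodd' : Odd (orderOf c) := Odd.of_dvd_nat hodd h2
    have h3 : orderOf c = 1 := by
      rcases (Nat.dvd_prime Nat.prime_two).mp h1 with h | h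
      · exact h
      · exact absurd (h ▸ hodd') (by decide)
    exact orderOf_eq_one_iff.mp h3
  haveI : Unique {c : ClassGroup (𝓞 L) // c ^ 2 = 1} :=
    { default := ⟨1, one_pow 2⟩
      uniq := fun c => Subtype.ext (hsub c.1 c.2) }
  exact Nat.card_unique

/-! ## §3 The ramification of `ℚ(ζ_{2^{k+2}}) / ℚ(ζ_{2^{k+2}})⁺`: exactly one finite prime ramifies -/

section Ramification

variable (N : Type) [Field N] [NumberField N] (k : ℕ) [hN : IsCyclotomicExtension {2 ^ (k + 2)} ℚ N]

/-- The rational prime under a nonzero prime of a ring of integers: a prime number `q` with `P ∣ q`. [folklore] -/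
private theorem exists_prime_liesOver {L : Type*} [Field L] [NumberField L] (P : Ideal (𝓞 L)) [P.IsMaximal] :
    ∃ q : ℕ, q.Prime ∧ P.LiesOver (Ideal.span {(q : ℤ)}) := by
  have hP0 : P ≠ ⊥ := Ring.ne_bot_of_isMaximal_of_not_isField ‹_› (RingOfIntegers.not_isField L)
  haveI : (P.under ℤ).IsPrime := Ideal.IsPrime.under ℤ P
  have hPZ0 : P.under ℤ ≠ ⊥ := mt Ideal.eq_bot_of_comap_eq_bot hP0
  set g := Submodule.IsPrincipal.generator (P.under ℤ) with hgdef
  have hg : Ideal.span {g} = P.under ℤ := Ideal.span_singleton_generator (P.under ℤ)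
  have hg0 : g ≠ 0 := fun h => hPZ0 (by rw [← hg, h, Ideal.span_singleton_eq_bot])
  have hgprime : Prime g := (Ideal.span_singleton_prime hg0).mp (hg.symm ▸ inferInstance)
  refine ⟨g.natAbs, Int.prime_iff_natAbs_prime.mp hgprime, ⟨?_⟩⟩
  rw [Int.span_natAbs, hg]

include hN in
/-- **In `ℚ(ζ_{2^{k+2}})` every prime above `2` has ramification index `2^{k+1} = [N : ℚ]` over `ℤ`** (it is `(ζ − 1)`, Mathlib).
[cite: Washington1997, Lemma 1.4 and Prop. 2.1] -/
theorem ramificationIdx_eq_two_pow_of_liesOver_two (P : Ideal (𝓞 N)) [P.IsMaximal]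
    [hP : P.LiesOver (Ideal.span {((2 : ℕ) : ℤ)})] : P.ramificationIdx ℤ = 2 ^ (k + 1) := by
  haveI : Fact (Nat.Prime 2) := ⟨Nat.prime_two⟩
  haveI : IsCyclotomicExtension {2 ^ (k + 1 + 1)} ℚ N := by
    rw [show k + 1 + 1 = k + 2 by ring]; exact hN
  have hζ := IsCyclotomicExtension.zeta_spec (2 ^ (k + 1 + 1)) ℚ N
  have hPeq := IsCyclotomicExtension.Rat.eq_span_zeta_sub_one_of_liesOver 2 (k + 1) N hζ P
  have h := IsCyclotomicExtension.Rat.ramificationIdx_span_zeta_sub_one 2 (k + 1) hζ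
  rw [← hPeq] at h
  rw [h]
  norm_num

include hN in
/-- **`ℚ(ζ_{2^{k+2}})⁺` has at most one prime above `2`**: two primes of `N⁺` above `2` have primes of `N` above them, both equal to
`(ζ − 1)`, so they coincide. [cite: Washington1997, Prop. 2.1] -/
theorem eq_of_liesOver_two_maximalRealSubfield [IsCMField N]
    (v v' : HeightOneSpectrum (𝓞 (maximalRealSubfield N)))
    (hv : v.asIdeal.LiesOver (Ideal.span {((2 : ℕ) : ℤ)})) (hv' : v'.asIdeal.LiesOver (Ideal.span {((2 : ℕ) : ℤ)})) :
    v = v' := by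
  haveI : Fact (Nat.Prime 2) := ⟨Nat.prime_two⟩
  haveI : IsCyclotomicExtension {2 ^ (k + 1 + 1)} ℚ N := by
    rw [show k + 1 + 1 = k + 2 by ring]; exact hN
  have hζ := IsCyclotomicExtension.zeta_spec (2 ^ (k + 1 + 1)) ℚ N
  haveI := v.isPrime
  haveI := v'.isPrime
  obtain ⟨⟨P, hP, hPv⟩⟩ := v.asIdeal.nonempty_primesOver (S := 𝓞 N)
  obtain ⟨⟨P', hP', hP'v⟩⟩ := v'.asIdeal.nonempty_primesOver (S := 𝓞 N)
  haveI := hP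
  haveI := hP'
  haveI : P.LiesOver (Ideal.span {((2 : ℕ) : ℤ)}) := by
    haveI := hPv; haveI := hv; exact Ideal.LiesOver.trans P v.asIdeal (Ideal.span {((2 : ℕ) : ℤ)})
  haveI : P'.LiesOver (Ideal.span {((2 : ℕ) : ℤ)}) := by
    haveI := hP'v; haveI := hv'; exact Ideal.LiesOver.trans P' v'.asIdeal (Ideal.span {((2 : ℕ) : ℤ)})
  have hP0 : P ≠ ⊥ := Ideal.ne_bot_of_liesOver_of_ne_bot v.ne_bot P
  have hP'0 : P' ≠ ⊥ := Ideal.ne_bot_of_liesOver_of_ne_bot v'.ne_bot P'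
  haveI : P.IsMaximal := hP.isMaximal hP0
  haveI : P'.IsMaximal := hP'.isMaximal hP'0
  have h1 := IsCyclotomicExtension.Rat.eq_span_zeta_sub_one_of_liesOver 2 (k + 1) N hζ P
  have h2 := IsCyclotomicExtension.Rat.eq_span_zeta_sub_one_of_liesOver 2 (k + 1) N hζ P'
  have hPP' : P = P' := h1.trans h2.symm
  apply HeightOneSpectrum.ext
  rw [hPv.over, hP'v.over, hPP']

include hN in
/-- **`ℚ(ζ_{2^{k+2}})/ℚ(ζ_{2^{k+2}})⁺` is ramified at the prime of `N⁺` above `2`**: for `P ∣ v ∣ 2`,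
`2^{k+1} = e(P ∣ 2) = e(v ∣ 2) · e(P ∣ v)` with `e(v ∣ 2) ≤ [N⁺ : ℚ] = 2^k`, so `e(P ∣ v) ≥ 2`. [cite: Washington1997, Prop. 2.1] -/
theorem not_isUnramifiedIn_maximalRealSubfield_of_liesOver_two [IsCMField N]
    (v : HeightOneSpectrum (𝓞 (maximalRealSubfield N))) (hv : v.asIdeal.LiesOver (Ideal.span {((2 : ℕ) : ℤ)})) :
    ¬ Algebra.IsUnramifiedIn (𝓞 N) v.asIdeal := by
  haveI : Fact (Nat.Prime 2) := ⟨Nat.prime_two⟩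
  haveI := v.isPrime
  intro hunr
  obtain ⟨⟨P, hP, hPv⟩⟩ := v.asIdeal.nonempty_primesOver (S := 𝓞 N)
  haveI := hP
  haveI := hPv
  have hP0 : P ≠ ⊥ := Ideal.ne_bot_of_liesOver_of_ne_bot v.ne_bot P
  haveI : P.IsMaximal := hP.isMaximal hP0
  haveI : P.LiesOver (Ideal.span {((2 : ℕ) : ℤ)}) := by
    haveI := hv; exact Ideal.LiesOver.trans P v.asIdeal (Ideal.span {((2 : ℕ) : ℤ)})
  -- `e(P | v) = 1` from unramifiedness, `e(P | 2) = 2^{k+1}`, tower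
  have hePv : P.ramificationIdx (𝓞 (maximalRealSubfield N)) = 1 := hunr.ramificationIdx_eq_one hPv
  have heP : P.ramificationIdx ℤ = 2 ^ (k + 1) := ramificationIdx_eq_two_pow_of_liesOver_two N k P
  have htower : P.ramificationIdx ℤ =
      v.asIdeal.ramificationIdx ℤ * P.ramificationIdx (𝓞 (maximalRealSubfield N)) :=
    Ideal.ramificationIdx_tower v.asIdeal P
  rw [heP, hePv, mul_one] at htower
  -- `e(v | 2) ≤ [N⁺ : ℚ] = 2^k`
  have hle : v.asIdeal.ramificationIdx ℤ ≤ Module.finrank ℚ (maximalRealSubfield N) := by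
    have h2 : (Ideal.span {((2 : ℕ) : ℤ)} : Ideal ℤ) ≠ ⊥ := by
      rw [Ne, Ideal.span_singleton_eq_bot]; norm_num
    haveI : (Ideal.span {((2 : ℕ) : ℤ)} : Ideal ℤ).IsMaximal := Int.ideal_span_isMaximal_of_prime 2
    haveI := hv
    rw [← Ideal.ramificationIdx'_eq_ramificationIdx (Ideal.span {((2 : ℕ) : ℤ)}) v.asIdeal h2]
    exact Ideal.ramificationIdx_le_finrank (𝓞 (maximalRealSubfield N)) ℚ (maximalRealSubfield N) v.asIdeal
  have hdegN : Module.finrank ℚ N = 2 ^ (k + 1) := by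
    haveI : IsCyclotomicExtension {2 ^ (k + 1 + 1)} ℚ N := by
      rw [show k + 1 + 1 = k + 2 by ring]; exact hN
    rw [IsCyclotomicExtension.Rat.finrank (2 ^ (k + 1 + 1)) N, Nat.totient_prime_pow_succ Nat.prime_two]
    norm_num
  have hdeg : Module.finrank ℚ (maximalRealSubfield N) * 2 = 2 ^ (k + 1) := by
    rw [← hdegN, ← Module.finrank_mul_finrank ℚ (maximalRealSubfield N) N, (IsCMField.isQuadraticExtension N).finrank_eq_two]
  have : 2 ^ (k + 1) * 2 ≤ 2 ^ (k + 1) := by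
    calc 2 ^ (k + 1) * 2 = v.asIdeal.ramificationIdx ℤ * 2 := by rw [htower]
      _ ≤ Module.finrank ℚ (maximalRealSubfield N) * 2 := Nat.mul_le_mul_right 2 hle
      _ = 2 ^ (k + 1) := hdeg
  have hpos : 0 < 2 ^ (k + 1) := pow_pos two_pos _
  omega

include hN in
/-- **`ℚ(ζ_{2^{k+2}})/ℚ(ζ_{2^{k+2}})⁺` is unramified at every finite prime of `N⁺` not above `2`**: a prime `P` of `N` above an odd
rational prime `q` has `e(P ∣ q) = 1` (Mathlib `ramificationIdx_eq_of_not_dvd`), hence `e(P ∣ P ∩ N⁺) = 1` (tower).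
[cite: Washington1997, Prop. 2.3] -/
theorem isUnramifiedIn_maximalRealSubfield_of_not_liesOver_two [IsCMField N]
    (v : HeightOneSpectrum (𝓞 (maximalRealSubfield N))) (hv : ¬ v.asIdeal.LiesOver (Ideal.span {((2 : ℕ) : ℤ)})) :
    Algebra.IsUnramifiedIn (𝓞 N) v.asIdeal := by
  haveI := v.isPrime
  rw [Algebra.isUnramifiedIn_iff_forall_ramificationIdx_eq_one]
  intro P hP hPv
  have hP0 : P ≠ ⊥ := Ideal.ne_bot_of_liesOver_of_ne_bot v.ne_bot P
  haveI : P.IsMaximal := hP.isMaximal hP0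
  obtain ⟨q, hq, hPq⟩ := exists_prime_liesOver P
  haveI : Fact q.Prime := ⟨hq⟩
  haveI := hPq
  -- `q ≠ 2`
  have hq2 : q ≠ 2 := by
    rintro rfl
    haveI := hPv
    exact hv (Ideal.LiesOver.tower_bot P v.asIdeal (Ideal.span {((2 : ℕ) : ℤ)}))
  have hndvd : ¬ q ∣ 2 ^ (k + 2) := fun h =>
    hq2 ((Nat.prime_dvd_prime_iff_eq hq Nat.prime_two).mp (hq.dvd_of_dvd_pow h))
  haveI : NeZero (2 ^ (k + 2)) := ⟨pow_ne_zero _ two_ne_zero⟩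
  have heZ : P.ramificationIdx ℤ = 1 :=
    IsCyclotomicExtension.Rat.ramificationIdx_eq_of_not_dvd (p := q) (K := N) (P := P) hndvd
  haveI := hPv
  have htower : P.ramificationIdx ℤ =
      v.asIdeal.ramificationIdx ℤ * P.ramificationIdx (𝓞 (maximalRealSubfield N)) :=
    Ideal.ramificationIdx_tower v.asIdeal P
  rw [heZ] at htower
  exact Nat.eq_one_of_mul_eq_one_left htower.symm

end Ramification

/-! ## §4 The narrow class number of `ℚ(ζ_{2^{k+2}})⁺` is odd -/

section Narrow

variable (N : Type) [Field N] [NumberField N] (k : ℕ) [hN : IsCyclotomicExtension {2 ^ (k + 2)} ℚ N]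

include hN in
/-- **Weber–Hasse: the NARROW class number of `ℚ(ζ_{2^{k+2}})⁺` is odd** (equivalently: its totally positive units are squares of units).
Horie's Lemma 1 (ii) at `t = 1` for the CM field `N = ℚ(ζ_{2^{k+2}})` (`h(N⁺)` odd, `N/N⁺` ramified exactly at the prime above `2`):
`#Cl(N)[2] · h(N⁺) = h⁺(N⁺)`, and `#Cl(N)[2] = 1` because `h(N)` is odd (Weber).
[cite: Horie1994, §1 Lemma 1 (ii)] [cite: Washington1997, Cor. 10.5] [cite: Okazaki2000, §3 Lemma 15] -/
theorem odd_narrowClassNumber_maximalRealSubfield_of_isCyclotomicExtension_two_pow :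
    Odd (narrowClassNumber (maximalRealSubfield N)) := by
  haveI : IsCMField N := isCMField_of_isCyclotomicExtension_two_pow N k
  haveI : Fact (Nat.Prime 2) := ⟨Nat.prime_two⟩
  -- the prime `v₀` of `N⁺` above `2`
  have h2max : (Ideal.span {((2 : ℕ) : ℤ)} : Ideal ℤ).IsMaximal := Int.ideal_span_isMaximal_of_prime 2
  haveI := h2max
  obtain ⟨⟨Q, hQ, hQ2⟩⟩ := (Ideal.span {((2 : ℕ) : ℤ)} : Ideal ℤ).nonempty_primesOver (S := 𝓞 (maximalRealSubfield N))
  have h2ne : (Ideal.span {((2 : ℕ) : ℤ)} : Ideal ℤ) ≠ ⊥ := by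
    rw [Ne, Ideal.span_singleton_eq_bot]; norm_num
  haveI := hQ
  haveI := hQ2
  have hQ0 : Q ≠ ⊥ := Ideal.ne_bot_of_liesOver_of_ne_bot h2ne Q
  let v₀ : HeightOneSpectrum (𝓞 (maximalRealSubfield N)) := ⟨Q, hQ, hQ0⟩
  have hv₀ : v₀.asIdeal.LiesOver (Ideal.span {((2 : ℕ) : ℤ)}) := hQ2
  have hram := not_isUnramifiedIn_maximalRealSubfield_of_liesOver_two N k v₀ hv₀
  have hunr : ∀ v : HeightOneSpectrum (𝓞 (maximalRealSubfield N)), v ≠ v₀ →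
      Algebra.IsUnramifiedIn (𝓞 N) v.asIdeal := by
    intro v hne
    refine isUnramifiedIn_maximalRealSubfield_of_not_liesOver_two N k v fun hv => hne ?_
    exact eq_of_liesOver_two_maximalRealSubfield N k v v₀ hv hv₀
  have hoddF := odd_classNumber_maximalRealSubfield_of_isCyclotomicExtension_two_pow N k
  obtain ⟨-, h⟩ := IsCMField.card_twoTorsion_classGroup_eq_card_totPosUnitsModSq_of_odd_of_isUnramifiedIn N hoddF hram hunr
  rw [card_twoTorsion_classGroup_eq_one_of_odd_classNumber N (odd_classNumber_of_isCyclotomicExtension_two_pow N k), one_mul] at h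
  rw [← h]
  exact hoddF

end Narrow

end Literature.NumberTheory.NumberFields

end
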